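import Summits.Ventures.HodgeRepro2.T5SU11JacobiOrbitLawAsymptotic
import Summits.Ventures.HodgeRepro2.T5SU11PhaseTailCartan
import Mathlib.Analysis.SpecialFunctions.Trigonometric.Series

/-!
# The rescaled Cartan coordinate converges in law to the standard exponential law, for every `λ`

The Cartan coordinate `t(g)` (`cosh t(g) = |a(g)|`) satisfies `{t(g) > τ} = {log|a(g)| > log cosh τ}`
(`T5SU11PhaseTailCartan.setOf_cartanT_gt_eq`), and `log cosh u ∼ u²/2` at `0`:

  **`(u²/2)/(1 + u²/2) ≤ log cosh u ≤ u²/2`**   (`le_log_cosh`, `log_cosh_le`),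

from `1 + u²/2 ≤ cosh u` (`one_add_sq_div_two_le_cosh`: `cosh u − 1 − u²/2` is monotone on `[0, ∞)`, its
derivative `sinh u − u ≥ 0`) and Mathlib's `cosh u ≤ e^{u²/2}`. With the thresholds
`t_k = log cosh(√(2x/k))` one has `(k − 2) t_k → x` by the squeeze (`tendsto_scaled_log_cosh_threshold`), so the
limit law with general thresholds (`T5SU11JacobiOrbitLawAsymptotic.tendsto_phase_tail_prob_of_tendsto`)
gives

  **`P_{k,λ}(k t(g)²/2 > x) → e^{−x}`**,  i.e. `P_{k,λ}(t(g) > √(2x/k)) → e^{−x}`   (`tendsto_cartan_tail_prob_atTop`)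

for every real `λ` and every `x ≥ 0`: the rescaled Cartan coordinate `k t(g)²/2` converges in distribution to
`Exp(1)`, like the rescaled phase `k log|a|` (`T5SU11JacobiPhaseTailGroup`) and the rescaled orbit radius
`k|g·0|²/2` (`T5SU11JacobiOrbitLawAsymptotic`) — the three coordinates agree to first order near the
identity (`log|a| ∼ |g·0|²/2 ∼ t²/2`). At `λ = 0` the exact law is `P_k(t > τ) = cosh(τ)^{−(k−2)}`
(`T5SU11PhaseTailCartan`). Nothing is claimed about (N).

Blind lane: Mathlib + the HodgeRepro2 prefix only; no sorry; axioms ⊆ {propext, Classical.choice,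
Quot.sound}.
-/

namespace Summit.Ventures.HodgeRepro2.T5SU11JacobiCartanLawAsymptotic

open MeasureTheory MeasureTheory.Measure Metric Set Filter Topology
open T5SU11Unimodular T5SU11Fibration T5SU11Cartan T5SU11OneParameter T5SU11CartanProjection T5HaarCircle
  T5BergmanCoefficient T5SU11FibrationHaar T5SU11SphericalFunction T5SU11SphericalSymmetry
  T5SU11SphericalBounds T5SU11SphericalContinuous T5SU11JacobiIwasawa T5SU11JacobiTransform
  T5SU11JacobiWeight T5SU11KFiniteMajorantPow T5SU11PhaseLaw T5SU11PhaseLawLintegral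
  T5SU11JacobiLaplacePhase T5SU11PhaseTail T5SU11PhaseTailCartan T5SU11JacobiPhaseTailGroup
  T5SU11JacobiPhaseLawAsymptotic T5SU11JacobiOrbitLawAsymptotic
open scoped Real

/-! ### `log cosh u ∼ u²/2` -/

/-- **`1 + u²/2 ≤ cosh u`** for `u ≥ 0` (`cosh u − 1 − u²/2` is monotone on `[0, ∞)`: its derivative is
`sinh u − u ≥ 0`). -/
theorem one_add_sq_div_two_le_cosh {u : ℝ} (hu : 0 ≤ u) : 1 + u ^ 2 / 2 ≤ Real.cosh u := by
  have hmono : MonotoneOn (fun u : ℝ => Real.cosh u - (1 + u ^ 2 / 2)) (Ici 0) := by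
    refine monotoneOn_of_deriv_nonneg (convex_Ici 0) ?_ ?_ ?_
    · exact (Real.continuous_cosh.sub
        (continuous_const.add ((continuous_id.pow 2).div_const 2))).continuousOn
    · exact (Real.differentiable_cosh.sub
        ((differentiable_const (1 : ℝ)).add ((differentiable_id.pow 2).div_const 2))).differentiableOn
    · intro x hx
      rw [interior_Ici] at hx
      have h2 : HasDerivAt (fun u : ℝ => 1 + u ^ 2 / 2) x x := by
        have := ((hasDerivAt_pow 2 x).div_const 2).const_add 1
        refine this.congr_deriv ?_
        push_cast
        ring
      have hd : HasDerivAt (fun u : ℝ => Real.cosh u - (1 + u ^ 2 / 2)) (Real.sinh x - x) x :=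
        (Real.hasDerivAt_cosh x).sub h2
      rw [hd.deriv]
      have := Real.self_le_sinh_iff.mpr (le_of_lt hx)
      linarith
  have h := hmono (mem_Ici.mpr le_rfl) (mem_Ici.mpr hu) hu
  simp only [Real.cosh_zero, ne_eq, OfNat.ofNat_ne_zero, not_false_eq_true, zero_pow, zero_div,
    add_zero, sub_self] at h
  linarith

/-- `log cosh u ≤ u²/2`. -/
theorem log_cosh_le (u : ℝ) : Real.log (Real.cosh u) ≤ u ^ 2 / 2 := by
  rw [← Real.log_exp (u ^ 2 / 2)]
  exact Real.log_le_log (Real.cosh_pos u) (Real.cosh_le_exp_half_sq u)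

/-- `(u²/2)/(1 + u²/2) ≤ log cosh u` for `u ≥ 0` (`log(1 + y) ≥ y/(1 + y)`). -/
theorem le_log_cosh {u : ℝ} (hu : 0 ≤ u) : (u ^ 2 / 2) / (1 + u ^ 2 / 2) ≤ Real.log (Real.cosh u) := by
  have hy : 0 < 1 + u ^ 2 / 2 := by positivity
  have h1 : Real.log (1 + u ^ 2 / 2) ≤ Real.log (Real.cosh u) :=
    Real.log_le_log hy (one_add_sq_div_two_le_cosh hu)
  have h2 := Real.log_le_sub_one_of_pos (inv_pos.mpr hy)
  rw [Real.log_inv] at h2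
  have e : (1 + u ^ 2 / 2)⁻¹ - 1 = -((u ^ 2 / 2) / (1 + u ^ 2 / 2)) := by
    field_simp
    ring
  linarith

/-! ### The threshold `(k − 2) log cosh(√(2x/k)) → x` -/

/-- `x(k − 2)/(k + x) → x` as `k → ∞`. -/
theorem tendsto_mul_sub_two_div_add (x : ℝ) :
    Tendsto (fun k : ℝ => x * (k - 2) / (k + x)) atTop (𝓝 x) := by
  have h0 : Tendsto (fun k : ℝ => (2 + x) * x / (k + x)) atTop (𝓝 0) :=
    (tendsto_atTop_add_const_right atTop x tendsto_id).const_div_atTop ((2 + x) * x)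
  have h1 : Tendsto (fun k : ℝ => x - (2 + x) * x / (k + x)) atTop (𝓝 (x - 0)) :=
    tendsto_const_nhds.sub h0
  rw [sub_zero] at h1
  refine h1.congr' ?_
  filter_upwards [eventually_gt_atTop (|x| + 1)] with k hk
  have : k + x ≠ 0 := by linarith [neg_abs_le x]
  field_simp
  ring

/-- **`(k − 2) log cosh(√(2x/k)) → x`** for `x ≥ 0`. -/
theorem tendsto_scaled_log_cosh_threshold {x : ℝ} (hx : 0 ≤ x) :
    Tendsto (fun k : ℝ => (k - 2) * Real.log (Real.cosh (Real.sqrt (2 * x / k)))) atTop (𝓝 x) := by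
  refine tendsto_of_tendsto_of_tendsto_of_le_of_le' (tendsto_mul_sub_two_div_add x)
    (tendsto_mul_sub_two_div x) ?_ ?_
  · filter_upwards [eventually_gt_atTop (2 : ℝ)] with k hk
    have hk0 : 0 < k := by linarith
    have hu : 0 ≤ Real.sqrt (2 * x / k) := Real.sqrt_nonneg _
    have hsq : Real.sqrt (2 * x / k) ^ 2 = 2 * x / k := Real.sq_sqrt (by positivity)
    have h := le_log_cosh hu
    rw [hsq] at h
    have e : (2 * x / k / 2) / (1 + 2 * x / k / 2) = x / (k + x) := by
      have : k + x ≠ 0 := by linarith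
      field_simp
    rw [e] at h
    calc x * (k - 2) / (k + x) = (k - 2) * (x / (k + x)) := by ring
      _ ≤ (k - 2) * Real.log (Real.cosh (Real.sqrt (2 * x / k))) :=
        mul_le_mul_of_nonneg_left h (by linarith)
  · filter_upwards [eventually_gt_atTop (2 : ℝ)] with k hk
    have hk0 : 0 < k := by linarith
    have hsq : Real.sqrt (2 * x / k) ^ 2 = 2 * x / k := Real.sq_sqrt (by positivity)
    have h := log_cosh_le (Real.sqrt (2 * x / k))
    rw [hsq] at h
    calc (k - 2) * Real.log (Real.cosh (Real.sqrt (2 * x / k)))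
        ≤ (k - 2) * (2 * x / k / 2) := mul_le_mul_of_nonneg_left h (by linarith)
      _ = x * (k - 2) / k := by field_simp

section measure

variable [MeasurableSpace Circle] [BorelSpace Circle]

/-- **THE RESCALED CARTAN COORDINATE CONVERGES IN LAW TO `Exp(1)`**: for every `λ` and `x ≥ 0`,
`P_{k,λ}(t(g) > √(2x/k)) → e^{−x}` as `k → ∞`. -/
theorem tendsto_cartan_tail_prob_atTop (lam : ℝ) {x : ℝ} (hx : 0 ≤ x) :
    Tendsto (fun k : ℝ =>
        (∫ g in {g : SU11 | Real.sqrt (2 * x / k) < cartanT g},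
            (1 - ‖orbit g‖ ^ 2) ^ (k / 2) * sph lam g ∂(nu haarCircle))
          / ∫ g, (1 - ‖orbit g‖ ^ 2) ^ (k / 2) * sph lam g ∂(nu haarCircle))
      atTop (𝓝 (Real.exp (-x))) := by
  have ht0 : ∀ᶠ k : ℝ in atTop, 0 ≤ Real.log (Real.cosh (Real.sqrt (2 * x / k))) :=
    Filter.Eventually.of_forall fun k => Real.log_nonneg (Real.one_le_cosh _)
  have h := tendsto_phase_tail_prob_of_tendsto lam hx (tendsto_scaled_log_cosh_threshold hx) ht0
  refine h.congr' (Filter.Eventually.of_forall fun k => ?_)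
  simp only
  rw [setOf_cartanT_gt_eq (Real.sqrt_nonneg _)]

end measure

end Summit.Ventures.HodgeRepro2.T5SU11JacobiCartanLawAsymptotic
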